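import Mathlib
import Summits.ValiantsHypothesis.ValiantsHypothesis.Theorems.FifoMatchingNNMonotoneHardPadTests
import Summits.ValiantsHypothesis.ValiantsHypothesis.Theorems.FifoMatchingNNMonotoneHardBand
import HarnessLib

/-!
# Crux `NNMonotoneHard` (stmt-ValiantsHypothesis-11617): the thick-queue measure
# (piece (F) of `Cruxes/NNMonotoneHard/PROOF-PLAN.md`, up to the choice of parameters)

The thick-queue measure on the nest-free perfect matchings of `[2n]`, `2n = L + N + L`: the law of
the FIFO pairing of the padded word `U^L v D^L` for `v` uniform among the balanced middle words
whose prefix sums stay in `(-m, m)` (transported from `Fin (L + N + L)` to `Fin (2 * n)` along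
`Fin.cast`).  `exists_thick_measure`: for parameters with `K ≥ 2L + 4m + 2`, `JK + 1 ≤ N`,
`4r ≤ J`, `2mr + 3m ≤ L`, `1 ≤ m ≤ L`, a block region large against `2n`, and a band estimate
`2N e^{-m²/(2N)} ≤ 1/(2N)`, this is a probability weighting under which EVERY balanced split
`S ⊆ [2n]` (`2n < 3|S| ≤ 4n`) is respected with mass at most `2N · (3/4)^r`: the respecting words
pass `≥ r` boundary tests (pieces (C), (D)), each test passes with probability `3/4` (piece (B)),
and the conditioning costs a factor `≤ 2N` (piece (E)).

Honest framing: a monotone lower-bound construction for ONE candidate family; VP ≠ VNP is not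
moved by anything here.  No definitions, no named facts.
-/

noncomputable section

-- Sub = Summit single-conjunct layout: the duplicated namespace component is mandated by the tree.
set_option linter.dupNamespace false

namespace Summit.ValiantsHypothesis.ValiantsHypothesis.Theorems.FifoMatching.NNMonotoneHard

open Finset Literature.Computability.AlgebraicComplexity
open scoped NNReal

/-! ### Transport along `Fin.cast` -/

/-- Conjugating a nest-free perfect matching by `Fin.cast`. [folklore] -/
theorem cast_conj_mem_nestFreeMatchings {a b : ℕ} (hab : a = b) {M' : Fin a → Fin a}
    (hM : M' ∈ nestFreeMatchings a) :
    (fun i : Fin b => Fin.cast hab (M' (Fin.cast hab.symm i))) ∈ nestFreeMatchings b := by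
  subst hab
  simpa using hM

/-- Respecting a set is invariant under the `Fin.cast` conjugation. [folklore] -/
theorem respects_cast_conj_iff {a b : ℕ} (hab : a = b) (M' : Fin a → Fin a) (S : Finset (Fin b)) :
    (∀ i : Fin b, i ∈ S ↔ Fin.cast hab (M' (Fin.cast hab.symm i)) ∈ S) ↔
      ∀ j : Fin a, Fin.cast hab j ∈ S ↔ Fin.cast hab (M' j) ∈ S := by
  subst hab
  simp

/-! ### Prefix sums versus letter counts -/

/-- The signed prefix sum of a word is `#U<j − #D<j`. [folklore] -/
theorem prefixSum_eq_card_sub_card {N : ℕ} (v : Fin N → Bool) (j : ℕ) :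
    (∑ i : Fin N, (if (i : ℕ) < j then (if v i then (1 : ℝ) else -1) else 0))
      = (((univ : Finset (Fin N)).filter fun p => p.val < j ∧ v p = true).card : ℝ)
        - (((univ : Finset (Fin N)).filter fun p => p.val < j ∧ v p = false).card : ℝ) := by
  classical
  rw [card_filter, card_filter, Nat.cast_sum, Nat.cast_sum, ← sum_sub_distrib]
  refine sum_congr rfl fun i _ => ?_
  by_cases h : (i : ℕ) < j <;> cases v i <;> simp [h]

/-! ### The measure -/

/-- **The thick-queue measure and its spread.**  See the module docstring. [folklore] -/
theorem exists_thick_measure {n L N m K J r : ℕ} (hM : L + N + L = 2 * n)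
    (hmL : m ≤ L) (hm : 1 ≤ m) (hK : 2 * L + 4 * m + 2 ≤ K) (hJ : J * K + 1 ≤ N)
    (hr1 : 4 * r ≤ J) (hr3 : 2 * m * r + 3 * m ≤ L)
    (hreg : 3 * (2 * K * r + (2 * n - J * K)) ≤ 2 * n)
    (hNpos : 0 < N)
    (hband : 2 * (N : ℝ) * Real.exp (-((m : ℝ) ^ 2 / (2 * N))) * 2 ^ N ≤ 2 ^ N / (2 * N)) :
    ∃ μ : (Fin (2 * n) → Fin (2 * n)) → ℝ≥0,
      (∑ Mt ∈ nestFreeMatchings (2 * n), μ Mt = 1) ∧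
      ∀ S : Finset (Fin (2 * n)), 2 * n < 3 * S.card → 3 * S.card ≤ 4 * n →
        (∑ Mt ∈ (nestFreeMatchings (2 * n)).filter (fun Mt => ∀ i, i ∈ S ↔ Mt i ∈ S), μ Mt)
          ≤ (2 * N : ℝ≥0) * ((3 : ℝ≥0) / 4) ^ r := by
  classical
  -- balanced thick middle words
  set BB : Finset (Fin N → Bool) := univ.filter fun v =>
    2 * ((univ : Finset (Fin N)).filter fun p => v p = true).card = N ∧
      ∀ j, j ≤ N →
        ((univ : Finset (Fin N)).filter fun p => p.val < j ∧ v p = false).card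
          < ((univ : Finset (Fin N)).filter fun p => p.val < j ∧ v p = true).card + m ∧
        ((univ : Finset (Fin N)).filter fun p => p.val < j ∧ v p = true).card
          < ((univ : Finset (Fin N)).filter fun p => p.val < j ∧ v p = false).card + m
    with hBB
  -- the map to matchings of `Fin (2n)`
  set f : (Fin N → Bool) → (Fin (2 * n) → Fin (2 * n)) := fun v =>
    if hb : 2 * ((univ : Finset (Fin N)).filter fun p => v p = true).card = N then
      fun i => Fin.cast hM (fifo (padWord L N v) (balanced_padWord v hb) (Fin.cast hM.symm i))
    else id with hf
  have hfmem : ∀ v ∈ BB, f v ∈ nestFreeMatchings (2 * n) := by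
    intro v hv
    obtain ⟨hb, hbd⟩ := (mem_filter.1 hv).2
    simp only [hf, dif_pos hb]
    exact cast_conj_mem_nestFreeMatchings hM
      (fifo_mem_nestFreeMatchings (isBallot_padWord v hb (fun j hj => (hbd j hj).1) hmL))
  -- `BB` is large: `#BB ≥ 2^N / (2N)`
  obtain ⟨N2, hN2⟩ : ∃ N2, N = 2 * N2 := ⟨n - L, by omega⟩
  have hBal : (2 : ℝ) ^ N / N ≤ (((univ : Finset (Fin N → Bool)).filter fun v =>
      2 * ((univ : Finset (Fin N)).filter fun p => v p = true).card = N).card : ℝ) := by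
    have hN2pos : 0 < N2 := by omega
    have h4 := four_pow_le_card_filter_balanced hN2pos
    -- rewrite `Fin (2 * N2)` as `Fin N`
    subst hN2
    have h4' : (4 : ℝ) ^ N2 ≤ 2 * N2 * (((univ : Finset (Fin (2 * N2) → Bool)).filter fun v =>
        ((univ : Finset (Fin (2 * N2))).filter fun i => v i = true).card = N2).card : ℝ) := by
      exact_mod_cast h4
    have hset : ((univ : Finset (Fin (2 * N2) → Bool)).filter fun v =>
        ((univ : Finset (Fin (2 * N2))).filter fun i => v i = true).card = N2)
        = ((univ : Finset (Fin (2 * N2) → Bool)).filter fun v =>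
          2 * ((univ : Finset (Fin (2 * N2))).filter fun p => v p = true).card = 2 * N2) := by
      ext v; simp only [mem_filter, mem_univ, true_and]; omega
    rw [hset] at h4'
    have h42 : (4 : ℝ) ^ N2 = 2 ^ (2 * N2) := by
      rw [pow_mul]; norm_num
    rw [h42] at h4'
    rw [div_le_iff₀ (by positivity)]
    push_cast
    linarith
  have hBandc : ((((univ : Finset (Fin N → Bool)).filter fun v =>
      2 * ((univ : Finset (Fin N)).filter fun p => v p = true).card = N) \ BB).card : ℝ)
      ≤ 2 * N * Real.exp (-((m : ℝ) ^ 2 / (2 * N))) * 2 ^ N := by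
    refine le_trans ?_ (card_filter_exists_abs_prefixSum_ge_le (N := N) (m := m)
      (by exact_mod_cast hm))
    refine Nat.cast_le.2 (card_le_card fun v hv => ?_)
    rw [mem_sdiff, mem_filter, hBB, mem_filter] at hv
    obtain ⟨⟨-, hb⟩, hnot⟩ := hv
    rw [mem_filter]
    refine ⟨mem_univ _, ?_⟩
    by_contra hall
    apply hnot
    refine ⟨mem_univ _, hb, fun j hj => ?_⟩
    have hj' : ¬ ((m : ℝ) ≤ |∑ i : Fin N, (if (i : ℕ) < j then (if v i then (1 : ℝ) else -1) else 0)|) :=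
      fun h => hall ⟨j, hj, h⟩
    rw [prefixSum_eq_card_sub_card, not_le, abs_lt] at hj'
    obtain ⟨h1, h2⟩ := hj'
    constructor
    · have : ((((univ : Finset (Fin N)).filter fun p => p.val < j ∧ v p = false).card : ℝ))
          < (((univ : Finset (Fin N)).filter fun p => p.val < j ∧ v p = true).card : ℝ) + m := by
        linarith
      exact_mod_cast this
    · have : ((((univ : Finset (Fin N)).filter fun p => p.val < j ∧ v p = true).card : ℝ))
          < (((univ : Finset (Fin N)).filter fun p => p.val < j ∧ v p = false).card : ℝ) + m := by
        linarith
      exact_mod_cast this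
  have hBBcard : (2 : ℝ) ^ N / (2 * N) ≤ (BB.card : ℝ) := by
    have hsub : BB ⊆ ((univ : Finset (Fin N → Bool)).filter fun v =>
        2 * ((univ : Finset (Fin N)).filter fun p => v p = true).card = N) := by
      intro v hv; rw [hBB, mem_filter] at hv; rw [mem_filter]; exact ⟨hv.1, hv.2.1⟩
    have hcard := card_sdiff_add_card_eq_card hsub
    have hcast : (BB.card : ℝ) = ((((univ : Finset (Fin N → Bool)).filter fun v =>
        2 * ((univ : Finset (Fin N)).filter fun p => v p = true).card = N).card : ℝ))
        - ((((univ : Finset (Fin N → Bool)).filter fun v =>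
          2 * ((univ : Finset (Fin N)).filter fun p => v p = true).card = N) \ BB).card : ℝ) := by
      rw [← hcard]; push_cast; ring
    rw [hcast]
    have hNr : (0 : ℝ) < N := by exact_mod_cast hNpos
    have : (2 : ℝ) ^ N / (2 * N) = 2 ^ N / N - 2 ^ N / (2 * N) := by
      field_simp; ring
    rw [this]
    linarith
  have hBBpos : 0 < BB.card := by
    have : (0 : ℝ) < BB.card := lt_of_lt_of_le (by positivity) hBBcard
    exact_mod_cast this
  -- the measure
  refine ⟨fun Mt => ((BB.filter fun v => f v = Mt).card : ℝ≥0) / (BB.card : ℝ≥0), ?_, ?_⟩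
  · -- total mass one
    rw [← sum_div, ← Nat.cast_sum, sum_card_fiberwise_eq_card_filter]
    rw [filter_true_of_mem hfmem, div_self]
    exact_mod_cast hBBpos.ne'
  · -- spread over every balanced split
    intro S hS1 hS2
    rw [← sum_div, ← Nat.cast_sum, sum_card_fiberwise_eq_card_filter]
    -- the colouring on `Fin (L + N + L)`
    set σ : Fin (L + N + L) → Bool := fun j => decide (Fin.cast hM j ∈ S) with hσ
    -- respecting words pass the tests
    set RS : Finset (Fin N → Bool) := univ.filter fun v =>
      ∃ hb : 2 * ((univ : Finset (Fin N)).filter fun p => v p = true).card = N,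
        (∀ j, j ≤ N →
          ((univ : Finset (Fin N)).filter fun p => p.val < j ∧ v p = false).card
            < ((univ : Finset (Fin N)).filter fun p => p.val < j ∧ v p = true).card + m ∧
          ((univ : Finset (Fin N)).filter fun p => p.val < j ∧ v p = true).card
            < ((univ : Finset (Fin N)).filter fun p => p.val < j ∧ v p = false).card + m) ∧
        ∀ k : Fin (openerSet (padWord L N v)).card,
          σ ((openerSet (padWord L N v)).orderEmbOfFin rfl k)
            = σ ((closerSet (padWord L N v)).orderEmbOfFin (balanced_padWord v hb) k) with hRS
    have hsubRS : (BB.filter fun v => f v ∈ (nestFreeMatchings (2 * n)).filter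
        fun Mt => ∀ i, i ∈ S ↔ Mt i ∈ S) ⊆ RS := by
      intro v hv
      rw [mem_filter, hBB, mem_filter, mem_filter] at hv
      obtain ⟨⟨-, hb, hbd⟩, -, hresp⟩ := hv
      rw [hRS, mem_filter]
      refine ⟨mem_univ _, hb, hbd, ?_⟩
      simp only [hf, dif_pos hb] at hresp
      rw [respects_cast_conj_iff hM] at hresp
      have hr := (respects_fifo_iff (h := balanced_padWord v hb)
        (univ.filter fun j : Fin (L + N + L) => Fin.cast hM j ∈ S)).1 (by
          intro j; simp only [mem_filter, mem_univ, true_and]; exact hresp j)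
      intro k
      have := hr k
      simp only [mem_filter, mem_univ, true_and] at this
      simp only [hσ]
      exact decide_eq_decide.2 this
    -- colour counts in the block region
    have hcol : ∀ b : Bool, 2 * K * r ≤ ((range (L + J * K)).filter fun t =>
        L ≤ t ∧ (if ht : t < L + N + L then σ ⟨t, ht⟩ else false) = b).card := by
      intro b
      -- the colour class `T` of `b` in `Fin (2n)`
      set T : Finset (Fin (2 * n)) := univ.filter fun i => decide (i ∈ S) = b with hT
      have hTcard : 2 * K * r + (2 * n - J * K) ≤ T.card := by
        rcases Bool.eq_false_or_eq_true b with hb | hb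
        · have hTS : T = S := by
            ext i; simp [hT, hb]
          rw [hTS]
          omega
        · -- `T = Sᶜ`
          have hTc : T = Sᶜ := by
            ext i; simp [hT, hb, mem_compl]
          rw [hTc, card_compl, Fintype.card_fin]
          omega
      -- positions of `T` inside the region inject into the counted set
      have hregion : (T.filter fun i => L ≤ i.val ∧ i.val < L + J * K).card + (2 * n - J * K)
          ≥ T.card := by
        have hsplit := card_filter_add_card_filter_not
          (s := T) (fun i : Fin (2 * n) => L ≤ i.val ∧ i.val < L + J * K)
        have hout : (T.filter fun i => ¬ (L ≤ i.val ∧ i.val < L + J * K)).card ≤ 2 * n - J * K := by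
          calc (T.filter fun i => ¬ (L ≤ i.val ∧ i.val < L + J * K)).card
              ≤ ((univ : Finset (Fin (2 * n))).filter
                  fun i => ¬ (L ≤ i.val ∧ i.val < L + J * K)).card :=
                card_le_card (filter_subset_filter _ (subset_univ _))
            _ = 2 * n - J * K := by
                have h1 := card_filter_add_card_filter_not
                  (s := (univ : Finset (Fin (2 * n)))) (fun i : Fin (2 * n) => L ≤ i.val ∧ i.val < L + J * K)
                have h2 : ((univ : Finset (Fin (2 * n))).filter
                    fun i => L ≤ i.val ∧ i.val < L + J * K).card = J * K := by
                  have hmap : (((univ : Finset (Fin (2 * n))).filter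
                      fun i => L ≤ i.val ∧ i.val < L + J * K).map Fin.valEmbedding)
                      = Finset.Ico L (L + J * K) := by
                    ext t
                    simp only [mem_map, mem_filter, mem_univ, true_and, Fin.valEmbedding_apply,
                      Finset.mem_Ico]
                    constructor
                    · rintro ⟨i, ⟨h1, h2⟩, rfl⟩; exact ⟨h1, h2⟩
                    · rintro ⟨h1, h2⟩; exact ⟨⟨t, by omega⟩, ⟨h1, h2⟩, rfl⟩
                  rw [← card_map Fin.valEmbedding, hmap, Nat.card_Ico]; omega
                rw [card_univ, Fintype.card_fin] at h1
                omega
        omega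
      have hinj : (T.filter fun i => L ≤ i.val ∧ i.val < L + J * K).card
          ≤ ((range (L + J * K)).filter fun t =>
            L ≤ t ∧ (if ht : t < L + N + L then σ ⟨t, ht⟩ else false) = b).card := by
        rw [← card_image_of_injective _ Fin.val_injective]
        refine card_le_card fun t ht => ?_
        obtain ⟨i, hi, rfl⟩ := mem_image.1 ht
        rw [mem_filter] at hi
        obtain ⟨hiT, hL, hJK⟩ := hi
        rw [mem_filter, mem_range]
        refine ⟨hJK, hL, ?_⟩
        rw [dif_pos (by omega)]
        rw [hT, mem_filter] at hiT
        simp only [hσ]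
        have hci : Fin.cast hM ⟨i.val, by omega⟩ = i := Fin.ext rfl
        rw [hci]
        exact hiT.2
      omega
    -- the tests: `#RS · 4^r ≤ 3^r · 2^N`
    have hRS : RS.card * 4 ^ r ≤ 3 ^ r * 2 ^ N := by
      rcases RS.eq_empty_or_nonempty with hRSe | ⟨v₀, hv₀⟩
      · rw [hRSe]; simp
      rw [hRS, mem_filter] at hv₀
      obtain ⟨-, hb₀, hbd₀, hresp₀⟩ := hv₀
      obtain ⟨x, hx⟩ := exists_many_boundaries_padWord (K := K) (J := J) (r := r) (Q := 2 * K * r)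
        v₀ hb₀ hbd₀ hmL hm hK hJ σ hresp₀ hcol hr1 le_rfl hr3
      have htest := card_resp_mul_four_pow_le (L := L) (N := N) hmL σ x
      rw [← hRS] at htest
      set P := ((univ : Finset (Fin N)).filter fun p => ∃ hp : 1 ≤ p.val,
          σ ⟨L + p.val - 1, by omega⟩ ≠ x ∧ σ ⟨L + p.val, by omega⟩ = x).card with hP
      -- divide by `4^(P - r)`
      obtain ⟨d, hd⟩ : ∃ d, P = r + d := ⟨P - r, by omega⟩
      rw [hd, pow_add, pow_add] at htest
      have h34 : (3 : ℕ) ^ d ≤ 4 ^ d := Nat.pow_le_pow_left (by norm_num) d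
      have hpos : 0 < 4 ^ d := pow_pos (by norm_num) d
      have : RS.card * 4 ^ r * 4 ^ d ≤ 3 ^ r * 2 ^ N * 4 ^ d := by
        calc RS.card * 4 ^ r * 4 ^ d = RS.card * (4 ^ r * 4 ^ d) := by ring
          _ ≤ 3 ^ r * 3 ^ d * 2 ^ N := htest
          _ ≤ 3 ^ r * 4 ^ d * 2 ^ N := by gcongr
          _ = 3 ^ r * 2 ^ N * 4 ^ d := by ring
      exact Nat.le_of_mul_le_mul_right this hpos
    have hcount : ((BB.filter fun v => f v ∈ (nestFreeMatchings (2 * n)).filter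
        fun Mt => ∀ i, i ∈ S ↔ Mt i ∈ S).card : ℝ) * 4 ^ r ≤ 3 ^ r * 2 ^ N := by
      have h1 := card_le_card hsubRS
      have : ((BB.filter fun v => f v ∈ (nestFreeMatchings (2 * n)).filter
          fun Mt => ∀ i, i ∈ S ↔ Mt i ∈ S).card) * 4 ^ r ≤ 3 ^ r * 2 ^ N :=
        (Nat.mul_le_mul_right _ h1).trans hRS
      exact_mod_cast this
    -- conclude in `ℝ`
    rw [← NNReal.coe_le_coe]
    push_cast
    rw [div_le_iff₀ (by exact_mod_cast hBBpos)]
    have hNr : (0 : ℝ) < N := by exact_mod_cast hNpos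
    have h4pos : (0 : ℝ) < 4 ^ r := by positivity
    -- `#resp ≤ 3^r 2^N / 4^r` and `2N (3/4)^r #BB ≥ (3/4)^r 2^N`
    have hA : ((BB.filter fun v => f v ∈ (nestFreeMatchings (2 * n)).filter
        fun Mt => ∀ i, i ∈ S ↔ Mt i ∈ S).card : ℝ) ≤ 3 ^ r * 2 ^ N / 4 ^ r := by
      rw [le_div_iff₀ h4pos]; exact hcount
    have hB : (3 : ℝ) ^ r * 2 ^ N / 4 ^ r ≤ 2 * N * (3 / 4) ^ r * BB.card := by
      have : (3 : ℝ) ^ r * 2 ^ N / 4 ^ r = (3 / 4) ^ r * (2 * N) * (2 ^ N / (2 * N)) := by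
        rw [div_pow]; field_simp
      rw [this]
      have h34r : (0 : ℝ) ≤ (3 / 4) ^ r * (2 * N) := by positivity
      calc (3 / 4 : ℝ) ^ r * (2 * N) * (2 ^ N / (2 * N))
          ≤ (3 / 4) ^ r * (2 * N) * BB.card := mul_le_mul_of_nonneg_left hBBcard h34r
        _ = 2 * N * (3 / 4) ^ r * BB.card := by ring
    exact hA.trans hB

end Summit.ValiantsHypothesis.ValiantsHypothesis.Theorems.FifoMatching.NNMonotoneHard
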